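/- Companion file (pub-rosobs cell, carver generation 50).  Statement PUBLISHED (H. Matsumura, *Commutative Ring
   Theory*, §27, the paragraph before Theorem 27.2: an ITERATIVE higher derivation `D_i ∘ D_j = C(i+j, i) D_{i+j}`
   satisfies `D_n = D_1^n / n!` over `ℚ`, and in characteristic `p`: `D_i = D_1^i / i!` for `i < p` and
   `D_1^p = 0`); formalisation OURS, over an arbitrary commutative ring.  INSTRUMENT for the cell's engine 1 (lemma
   IT (2) of THEOREM-FQ-eng1-g34; CARVER-NOTES-eng1-g34 T16) — NOT a resolution theorem. -/
import Mathlib.Algebra.CharP.Lemmas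
import Mathlib.Algebra.Field.ZMod
import Mathlib.Data.Nat.Prime.Factorial
import Mathlib.Algebra.BigOperators.NatAntidiagonal
import HarnessLib

/-!
# Iterative higher derivations (Hasse–Schmidt): `n! · D_n = D_1^n`, and `D_1^p = 0` in characteristic `p`

Topic: `Literature/RingTheory/Derivation`.  A **higher derivation** (of infinite length) of a commutative ring `A`
into itself is a sequence of additive maps `D = (D_0, D_1, D_2, …)` with `D_0 = id` and the higher Leibniz rule
`D_n(ab) = Σ_{i+j=n} D_i(a) D_j(b)`; it is **iterative** if `D_i ∘ D_j = C(i+j, i) · D_{i+j}` for all `i, j`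
(Matsumura, §27).  Mathlib has `Derivation` and the polynomial `Polynomial.hasseDeriv`, but no Hasse–Schmidt
structure; it is defined here ad hoc (`HigherDerivation`, `HigherDerivation.IsIterative`).

Results (Matsumura §27, before Thm. 27.2 — stated there for `k`-algebras; the composition identities below need
only additivity and iterativity, so they are proved for any family of additive maps `D : ℕ → A →+ A` with the
iterative rule, `IsIterativeFamily`, and then specialised):

* `IsIterativeFamily.factorial_nsmul_eq_iterate` : `n! • D n a = (D 1)^[n] a` for every `n` (any commutative ring,
  indeed any additive commutative monoid `A`);
* `IsIterativeFamily.iterate_eq_zero_of_le` : in characteristic `p ≠ 0`, `(D 1)^[n] = 0` for all `n ≥ p`; in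
  particular `(D 1)^[p] = 0` (`iterate_char_eq_zero`);
* `IsIterativeFamily.eq_inv_factorial_mul_iterate` : in prime characteristic `p`, for `n < p`,
  `D n a = (n!)⁻¹ · (D 1)^[n] a` — so `D_0, …, D_{p-1}` are determined by `D_1`;
* the same three statements for `E : HigherDerivation A` with `E.IsIterative` (`HigherDerivation.IsIterative.*`).

What is NOT here: existence / extension theorems for higher derivations (Thms. 27.1, 27.2), `0`-smoothness.
-/

namespace Literature.RingTheory.Derivation

open Finset

/-! ## Families of additive maps with the iterative composition rule -/

section Family

variable {A : Type*} [AddCommMonoid A]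

/-- An ITERATIVE family of additive self-maps `D = (D_0, D_1, …)`: `D_0 = id` and
`D_i (D_j a) = C(i+j, i) · D_{i+j} a` for all `i, j` (the composition rule of an iterative higher derivation; the
Leibniz rule is not part of this predicate because the identities below do not use it).
[cite: Matsumura1987, §27 (iterative higher derivations; before Thm. 27.2)] -/
structure IsIterativeFamily (D : ℕ → A →+ A) : Prop where
  /-- `D_0 = id` -/
  apply_zero : ∀ a : A, D 0 a = a
  /-- `D_i ∘ D_j = C(i+j, i) · D_{i+j}` -/
  comp : ∀ (i j : ℕ) (a : A), D i (D j a) = (i + j).choose i • D (i + j) a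

namespace IsIterativeFamily

variable {D : ℕ → A →+ A}

/-- `D_1 ∘ D_n = (n+1) · D_{n+1}` (the case `i = 1` of the iterative rule).
[cite: Matsumura1987, §27 (iterative higher derivations; before Thm. 27.2)] -/
theorem apply_one_apply (h : IsIterativeFamily D) (n : ℕ) (a : A) : D 1 (D n a) = (n + 1) • D (n + 1) a := by
  have := h.comp 1 n a
  rwa [Nat.add_comm 1 n, Nat.choose_one_right] at this

/-- **`n! · D_n = D_1^n`** for an iterative family, every `n` (Matsumura §27: over `ℚ` this reads
`D_n = D_1^n / n!`; no hypothesis on `A` is needed for the factorial form).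
[cite: Matsumura1987, §27 (iterative higher derivations; before Thm. 27.2)] -/
theorem factorial_nsmul_eq_iterate (h : IsIterativeFamily D) (n : ℕ) (a : A) :
    n.factorial • D n a = (D 1)^[n] a := by
  induction n with
  | zero => simp [h.apply_zero]
  | succ n ih =>
    rw [Function.iterate_succ_apply', ← ih, map_nsmul, h.apply_one_apply, Nat.factorial_succ, mul_nsmul]

end IsIterativeFamily

end Family

section CharP

variable {A : Type*} [CommRing A] {D : ℕ → A →+ A}

namespace IsIterativeFamily

/-- In characteristic `p ≠ 0`: **`D_1^n = 0` for every `n ≥ p`** (since `n! = 0` in `A`).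
[cite: Matsumura1987, §27 (iterative higher derivations; before Thm. 27.2)] -/
theorem iterate_eq_zero_of_le (h : IsIterativeFamily D) (p : ℕ) [CharP A p] (hp : p ≠ 0) {n : ℕ} (hn : p ≤ n)
    (a : A) : (D 1)^[n] a = 0 := by
  rw [← h.factorial_nsmul_eq_iterate, nsmul_eq_mul]
  have : ((n.factorial : ℕ) : A) = 0 :=
    (CharP.cast_eq_zero_iff A p _).2 (Nat.dvd_factorial (Nat.pos_of_ne_zero hp) hn)
  rw [this, zero_mul]

/-- In characteristic `p ≠ 0`: **`D_1^p = 0`** (Matsumura §27: "one cannot hope to extend any derivation to an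
iterative higher derivation"). [cite: Matsumura1987, §27 (iterative higher derivations; before Thm. 27.2)] -/
theorem iterate_char_eq_zero (h : IsIterativeFamily D) (p : ℕ) [CharP A p] (hp : p ≠ 0) (a : A) :
    (D 1)^[p] a = 0 :=
  h.iterate_eq_zero_of_le p hp le_rfl a

/-- `n!` is a unit of a ring of prime characteristic `p > n` (elementary).
[cite: Matsumura1987, §27 (iterative higher derivations; before Thm. 27.2)] -/
theorem isUnit_natCast_factorial_of_lt_char (p : ℕ) [hp : Fact p.Prime] [CharP A p] {n : ℕ} (hn : n < p) :
    IsUnit ((n.factorial : ℕ) : A) := by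
  have hnd : ¬ p ∣ n.factorial := fun hd => absurd (hp.out.dvd_factorial.mp hd) (not_le.mpr hn)
  have hz : ((n.factorial : ℕ) : ZMod p) ≠ 0 := by
    rwa [Ne, ZMod.natCast_eq_zero_iff]
  have hu : IsUnit ((n.factorial : ℕ) : ZMod p) := Ne.isUnit hz
  simpa using hu.map (ZMod.castHom (dvd_refl p) A)

/-- In prime characteristic `p`: **`D_n = (n!)⁻¹ · D_1^n` for `n < p`** — the components below `p` of an iterative
family are determined by `D_1`. [cite: Matsumura1987, §27 (iterative higher derivations; before Thm. 27.2)] -/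
theorem eq_inv_factorial_mul_iterate (h : IsIterativeFamily D) (p : ℕ) [Fact p.Prime] [CharP A p] {n : ℕ}
    (hn : n < p) (a : A) :
    D n a = ↑((isUnit_natCast_factorial_of_lt_char (A := A) p hn).unit⁻¹) * (D 1)^[n] a := by
  rw [← h.factorial_nsmul_eq_iterate, nsmul_eq_mul, ← mul_assoc, IsUnit.val_inv_mul, one_mul]

/-- Uniqueness below `p`: two iterative families in prime characteristic `p` with the same `D_1` agree in all
degrees `n < p`. [cite: Matsumura1987, §27 (iterative higher derivations; before Thm. 27.2)] -/
theorem eq_of_apply_one_eq (h : IsIterativeFamily D) {D' : ℕ → A →+ A} (h' : IsIterativeFamily D') (p : ℕ)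
    [Fact p.Prime] [CharP A p] (h1 : D 1 = D' 1) {n : ℕ} (hn : n < p) : D n = D' n := by
  ext a
  rw [h.eq_inv_factorial_mul_iterate p hn, h'.eq_inv_factorial_mul_iterate p hn, h1]

end IsIterativeFamily

end CharP

/-! ## Higher derivations (Hasse–Schmidt) -/

/-- A **higher derivation** of infinite length of a commutative ring `A` into itself (Hasse–Schmidt): additive maps
`D_0 = id, D_1, D_2, …` with `D_n(ab) = Σ_{i+j=n} D_i(a)·D_j(b)`.  (Matsumura defines `HS_k(A, B)` for `k`-algebras
`A → B`; this is the case `B = A`, `k = ℤ`.) [cite: Matsumura1987, §27 (higher derivations, `HS_k(A)`)] -/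
structure HigherDerivation (A : Type*) [CommRing A] where
  /-- the components `D_n` -/
  D : ℕ → A →+ A
  /-- `D_0 = id` -/
  apply_zero : ∀ a, D 0 a = a
  /-- the higher Leibniz rule -/
  leibniz : ∀ (n : ℕ) (a b : A), D n (a * b) = ∑ ij ∈ antidiagonal n, D ij.1 a * D ij.2 b

namespace HigherDerivation

variable {A : Type*} [CommRing A]

/-- `D_1` of a higher derivation satisfies the Leibniz rule `D_1(ab) = a·D_1(b) + D_1(a)·b` (the case `n = 1` of the
higher Leibniz rule, with `D_0 = id`). [cite: Matsumura1987, §27 (higher derivations, `HS_k(A)`)] -/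
theorem apply_one_mul (E : HigherDerivation A) (a b : A) : E.D 1 (a * b) = a * E.D 1 b + E.D 1 a * b := by
  rw [E.leibniz 1 a b, Nat.sum_antidiagonal_succ, Nat.antidiagonal_zero, sum_singleton]
  simp [E.apply_zero]

/-- A higher derivation is **iterative** if `D_i ∘ D_j = C(i+j, i)·D_{i+j}`.
[cite: Matsumura1987, §27 (iterative higher derivations; before Thm. 27.2)] -/
def IsIterative (E : HigherDerivation A) : Prop :=
  ∀ (i j : ℕ) (a : A), E.D i (E.D j a) = (i + j).choose i • E.D (i + j) a

/-- An iterative higher derivation is an iterative family (`D_0 = id` holds by definition).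
[cite: Matsumura1987, §27 (iterative higher derivations; before Thm. 27.2)] -/
theorem IsIterative.isIterativeFamily {E : HigherDerivation A} (h : E.IsIterative) : IsIterativeFamily E.D :=
  ⟨E.apply_zero, h⟩

namespace IsIterative

variable {E : HigherDerivation A}

/-- `n! · D_n = D_1^n` for an iterative higher derivation.
[cite: Matsumura1987, §27 (iterative higher derivations; before Thm. 27.2)] -/
theorem factorial_nsmul_eq_iterate (h : E.IsIterative) (n : ℕ) (a : A) : n.factorial • E.D n a = (E.D 1)^[n] a :=
  h.isIterativeFamily.factorial_nsmul_eq_iterate n a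

/-- `D_1^p = 0` for an iterative higher derivation in characteristic `p ≠ 0`.
[cite: Matsumura1987, §27 (iterative higher derivations; before Thm. 27.2)] -/
theorem iterate_char_eq_zero (h : E.IsIterative) (p : ℕ) [CharP A p] (hp : p ≠ 0) (a : A) :
    (E.D 1)^[p] a = 0 :=
  h.isIterativeFamily.iterate_char_eq_zero p hp a

/-- `D_n = (n!)⁻¹ · D_1^n` for `n < p`, for an iterative higher derivation in prime characteristic `p`.
[cite: Matsumura1987, §27 (iterative higher derivations; before Thm. 27.2)] -/
theorem eq_inv_factorial_mul_iterate (h : E.IsIterative) (p : ℕ) [Fact p.Prime] [CharP A p] {n : ℕ}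
    (hn : n < p) (a : A) :
    E.D n a = ↑((IsIterativeFamily.isUnit_natCast_factorial_of_lt_char (A := A) p hn).unit⁻¹) * (E.D 1)^[n] a :=
  h.isIterativeFamily.eq_inv_factorial_mul_iterate p hn a

end IsIterative

end HigherDerivation

end Literature.RingTheory.Derivation
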